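import Summits.HubbardSuperconductivity.HubbardSuperconductivity.Theorems.AnisotropyChordFerroSideTopOverlapDeficit
import Summits.HubbardSuperconductivity.HubbardSuperconductivity.Theorems.AnisotropyChordFerroSideLambdaLeFerroValue

/-!
# Route `AnisotropyChord`, crux `FerroSideChord` (stmt-HubbardSuperconductivity-19089), line
# `fm-monotone-anchor`: the FM-END WINDOW of the chord — the slice of the registered stub
# `stub_fmEndChord` next to `Δ = 1`, at every even side `L`

Notation of the route: `H_L(Δ) = xxzHamiltonian 1 (torusGraph 2 L) (-1) Δ` (`= hcbHamiltonian L Δ`),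
sector `K = {S^z_tot = 0}`, `Λ(ψ) = Re⟨ψ, S⁺_tot S⁻_tot ψ⟩`, `S(S+1) = (L²/2)(L²/2+1)`, the Ising
part of the pencil `W = H_L(1) - H_L(0)` (so `H_L(Δ) = H_L(1) - (1-Δ)W`).

The stub `stub_fmEndChord` asks `((1+Δ)/2)·S(S+1) ≤ Λ(ψ)` for all sector ground states on the
FIXED window `Δ ∈ [2/5, 1]`, uniformly in `L` (open).  At `Δ = 1` both sides equal `S(S+1)`
(`FerroPointValue`); this file proves that the chord holds on a window `[1 - ε_L, 1]` at every
even `L`, with `ε_L` explicit in the spectral gap of the isotropic ferromagnet: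

* `lambda_toC_ge_ferroValue_mul_sq_overlap` — `S(S+1)·⟨a₀, a⟩² ≤ Λ(a)` for the Dicke amplitude
  `a₀` (sector ground state of `H_L(1)`, a top eigenvector of `S⁺S⁻` by Tóth's maximality
  `raiseLower_form_le` + `FerroPointValue`) and any sector ground amplitude `a`
  (`re_form_ge_mul_sq_overlap_of_isTop`);
* `sectorGS_pencil_variational` — `E₀(Δ) ≤ ⟨a₀, H_L(Δ)a₀⟩` written on the affine pencil;
* **`fmEndChord_of_gap`** — for `Δ ≤ 1` with `(1-Δ)(4Dg + 8σ² + 8) ≤ g²` (`g` a sector gap of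
  `H_L(1)` above the Dicke state, `D = Σ|Wᵢₖ|`, `σ² = ‖W a₀‖²`) the chord bound holds for every
  normalised sector ground state of `H_L(Δ)` (`one_sub_sq_overlap_le_half_of_gap`: the overlap
  deficit with the Dicke state is `≤ (1-Δ)/2`);
* **`fmEndChord_window`**, `fmEndChord_nearOne` — `∃ ε > 0`, chord on `[1-ε, 1]` (the gap exists by
  Perron simplicity, `FerroSide.perron_gap`), the latter in the stub's binder shape.

`FerroPointValue` (route item, PROVED in the tree: `ferroPointValue_proof`) is taken by name as a
hypothesis, as in `AnisotropyChordFerroSideLambdaLeFerroValue`.  T. Kato (1966) II-§5.1;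
H. Tasaki (2020) §2.4, App. A.2–A.3; B. Tóth, Lett. Math. Phys. 28 (1993) 75.  No definition is
introduced.
-/

set_option linter.dupNamespace false

noncomputable section

open Matrix Complex Finset
open scoped ComplexConjugate ComplexOrder
open Literature.MathematicalPhysics.QuantumLattice hiding torusPhase torusNorm
open Literature.Probability.LatticeModels
open Summit.HubbardSuperconductivity.HubbardSuperconductivity.Theses.AnisotropyChord
open Summit.HubbardSuperconductivity.HubbardSuperconductivity.Theorems.AnisotropyChord.InsertionEntropy
open Summit.HubbardSuperconductivity.HubbardSuperconductivity.Theorems.AnisotropyChord.Stiffness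

namespace Summit.HubbardSuperconductivity.HubbardSuperconductivity.Theorems.AnisotropyChord.FerroSide

/-! ### The torus: `S⁺_tot S⁻_tot` on the `S^z_tot = 0` sector and the Dicke overlap bound -/

variable (L : ℕ) [NeZero L]

/-- `S⁺_tot S⁻_tot` is Hermitian (`S⁻_tot = (S⁺_tot)ᴴ`). [folklore] -/
theorem raiseLower_conjTranspose :
    (((∑ x : TorusSite 2 L, onSite x (spinRaise 1)) *
        (∑ y : TorusSite 2 L, onSite y (spinLower 1)) : Op (TorusSite 2 L) 2))ᴴ =
      ((∑ x : TorusSite 2 L, onSite x (spinRaise 1)) *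
        (∑ y : TorusSite 2 L, onSite y (spinLower 1)) : Op (TorusSite 2 L) 2) := by
  show (raiseOn 1 (Finset.univ : Finset (TorusSite 2 L)) * lowerOn 1 Finset.univ)ᴴ =
    raiseOn 1 Finset.univ * lowerOn 1 Finset.univ
  rw [lowerOn_eq_conjTranspose, conjTranspose_mul, conjTranspose_conjTranspose]

/-- `0 ≤ Re⟨φ, S⁺_tot S⁻_tot φ⟩` (`= ‖S⁻_tot φ‖²`). [folklore] -/
theorem re_form_raiseLower_nonneg (φ : TensorIndex (TorusSite 2 L) 2 → ℂ) :
    0 ≤ (star φ ⬝ᵥ (((∑ x : TorusSite 2 L, onSite x (spinRaise 1)) *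
        (∑ y : TorusSite 2 L, onSite y (spinLower 1)) : Op (TorusSite 2 L) 2) *ᵥ φ)).re := by
  show 0 ≤ (star φ ⬝ᵥ ((raiseOn 1 (Finset.univ : Finset (TorusSite 2 L)) *
    lowerOn 1 Finset.univ) *ᵥ φ)).re
  rw [← mulVec_mulVec,
    ← (isSu2Triple_on 1 (Finset.univ : Finset (TorusSite 2 L))).star_M_mulVec_dotProduct]
  exact (Complex.nonneg_iff.mp (dotProduct_star_self_nonneg _)).1

/-- `Re⟨φ, S⁺_tot S⁻_tot φ⟩ ≤ (L²/2)(L²/2 + 1)·‖φ‖²` on the `S^z_tot = 0` sector of the `L × L`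
torus, `L` even (`raiseLower_form_le`; Tóth 1993). [folklore] -/
theorem re_form_raiseLower_le_ferroValue_mul (hE : Even L) {φ : TensorIndex (TorusSite 2 L) 2 → ℂ}
    (hφ : φ ∈ spinZSector (Λ := TorusSite 2 L) 1 0) :
    (star φ ⬝ᵥ (((∑ x : TorusSite 2 L, onSite x (spinRaise 1)) *
        (∑ y : TorusSite 2 L, onSite y (spinLower 1)) : Op (TorusSite 2 L) 2) *ᵥ φ)).re ≤
      (L : ℝ) ^ 2 / 2 * ((L : ℝ) ^ 2 / 2 + 1) * (star φ ⬝ᵥ φ).re := by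
  obtain ⟨m, hm⟩ := hE
  have hcard : (Fintype.card (TorusSite 2 L) : ℝ) = (L : ℝ) ^ 2 := by
    rw [Fintype.card_fun, ZMod.card, Fintype.card_fin]; push_cast; ring
  have hlabel : (0 : ℝ) =
      (Fintype.card (TorusSite 2 L) : ℝ) * (1 : ℕ) / 2 - ((2 * m ^ 2 : ℕ) : ℝ) := by
    rw [hcard, hm]; push_cast; ring
  have h := raiseLower_form_le (Λ := TorusSite 2 L) 1 (2 * m ^ 2) hlabel hφ
  rw [hcard] at h
  have hPL : (raiseOn 1 (Finset.univ : Finset (TorusSite 2 L)) * lowerOn 1 Finset.univ) =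
      ((∑ x : TorusSite 2 L, onSite x (spinRaise 1)) *
        (∑ y : TorusSite 2 L, onSite y (spinLower 1))) := rfl
  rw [hPL] at h
  have hs : ((L : ℝ) ^ 2 * ((1 : ℕ) : ℝ) / 2 * ((L : ℝ) ^ 2 * ((1 : ℕ) : ℝ) / 2 + 1) - 0 * (0 - 1)) =
      (L : ℝ) ^ 2 / 2 * ((L : ℝ) ^ 2 / 2 + 1) := by push_cast; ring
  rw [hs] at h
  exact h

/-- **Dicke overlap bound.**  Given the route item `FerroPointValue` (PROVED in the tree,
`ferroPointValue_proof`; taken by name): for even `L`, the Perron amplitude `a₀` of the sector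
ground state of the isotropic ferromagnet `H_L(1)` (the `S^z_tot = 0` member of the top multiplet)
and the Perron amplitude `a` of the sector ground state of `H_L(Δ)` (any `Δ`) satisfy
`S(S+1)·⟨a₀, a⟩² ≤ Λ(toC a)`, `S(S+1) = (L²/2)(L²/2+1)`: the Dicke state attains the maximum of
`S⁺_tot S⁻_tot` on the sector (Tóth 1993), so it is a top eigenvector and the cross term vanishes
(`re_form_ge_mul_sq_overlap_of_isTop`). [folklore] -/
theorem lambda_toC_ge_ferroValue_mul_sq_overlap (hFPV : FerroPointValue) (hE : Even L)
    {a₀ : TensorIndex (TorusSite 2 L) 2 → ℝ} (ha₀ : IsPerronSectorGroundAmplitude L 1 0 a₀)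
    {Δ : ℝ} {a : TensorIndex (TorusSite 2 L) 2 → ℝ} (ha : IsPerronSectorGroundAmplitude L Δ 0 a) :
    (L : ℝ) ^ 2 / 2 * ((L : ℝ) ^ 2 / 2 + 1) * (∑ σ, a₀ σ * a σ) ^ 2 ≤
      (star (toC L a) ⬝ᵥ (((∑ x : TorusSite 2 L, onSite x (spinRaise 1)) *
        (∑ y : TorusSite 2 L, onSite y (spinLower 1)) : Op (TorusSite 2 L) 2) *ᵥ toC L a)).re := by
  have hval : (star (toC L a₀) ⬝ᵥ (((∑ x : TorusSite 2 L, onSite x (spinRaise 1)) *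
      (∑ y : TorusSite 2 L, onSite y (spinLower 1)) : Op (TorusSite 2 L) 2) *ᵥ toC L a₀)).re =
      (L : ℝ) ^ 2 / 2 * ((L : ℝ) ^ 2 / 2 + 1) :=
    hFPV L hE (toC L a₀) (toC_mem_of_isPerron L ha₀) (toC_unit_of_isPerron L ha₀)
      (hcb_mulVec_toC_of_isPerron L ha₀)
  exact re_form_ge_mul_sq_overlap_of_isTop (raiseLower_conjTranspose L)
    (spinZSector (Λ := TorusSite 2 L) 1 0) (toC_mem_of_isPerron L ha₀) (toC_unit_of_isPerron L ha₀)
    hval (fun φ hφ => re_form_raiseLower_le_ferroValue_mul L hE hφ)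
    (fun φ _ => re_form_raiseLower_nonneg L φ) (toC_mem_of_isPerron L ha)
    (toC_unit_of_isPerron L ha) (star_toC_dotProduct_toC L a₀ a)

/-! ### The pencil at the ferromagnetic end -/

/-- **Variational comparison along the pencil, exact form.**  For Perron amplitudes `a` (at `Δ`)
and `a₀` (at `1`) of the sector `S^z_tot = 0`:
`Re⟨a, H_L(1)a⟩ - (1-Δ)·Re⟨a, (H_L(1)-H_L(0))a⟩ = E₀(Δ) ≤ Re⟨a₀, H_L(Δ)a₀⟩ = E₀(1) - (1-Δ)·Re⟨a₀, (H_L(1)-H_L(0))a₀⟩`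
(the pencil is affine in `Δ`). Tasaki (2020) App. A.2. [folklore] -/
theorem sectorGS_pencil_variational {Δ : ℝ} {a a₀ : TensorIndex (TorusSite 2 L) 2 → ℝ}
    (ha : IsPerronSectorGroundAmplitude L Δ 0 a) (ha₀ : IsPerronSectorGroundAmplitude L 1 0 a₀) :
    (star (toC L a) ⬝ᵥ hcbHamiltonian L 1 *ᵥ toC L a).re -
        (1 - Δ) * (star (toC L a) ⬝ᵥ (hcbHamiltonian L 1 - hcbHamiltonian L 0) *ᵥ toC L a).re ≤
      lowestEnergyInSector 1 (hcbHamiltonian L 1) 0 -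
        (1 - Δ) * (star (toC L a₀) ⬝ᵥ (hcbHamiltonian L 1 - hcbHamiltonian L 0) *ᵥ toC L a₀).re := by
  have hψΔ := re_form_affine 1 (torusGraph 2 L) (-1) Δ (toC L a)
  have hψone := re_form_affine 1 (torusGraph 2 L) (-1) 1 (toC L a)
  have hψ₀Δ := re_form_affine 1 (torusGraph 2 L) (-1) Δ (toC L a₀)
  have hψ₀one := re_form_affine 1 (torusGraph 2 L) (-1) 1 (toC L a₀)
  have heψ := re_form_of_sectorGS 1 (torusGraph 2 L) (toC_unit_of_isPerron L ha)
    (hcb_mulVec_toC_of_isPerron L ha)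
  have heψ₀ := re_form_of_sectorGS 1 (torusGraph 2 L) (toC_unit_of_isPerron L ha₀)
    (hcb_mulVec_toC_of_isPerron L ha₀)
  have hvar := sectorEnergy_le_re_form 1 (torusGraph 2 L) (J := -1) (Δ := Δ)
    (toC_mem_of_isPerron L ha₀) (toC_unit_of_isPerron L ha₀)
  show (star (toC L a) ⬝ᵥ (xxzHamiltonian 1 (torusGraph 2 L) (-1) 1 *ᵥ toC L a)).re -
      (1 - Δ) * (star (toC L a) ⬝ᵥ ((xxzHamiltonian 1 (torusGraph 2 L) (-1) 1 -
        xxzHamiltonian 1 (torusGraph 2 L) (-1) 0) *ᵥ toC L a)).re ≤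
    lowestEnergyInSector 1 (xxzHamiltonian 1 (torusGraph 2 L) (-1) 1) 0 -
      (1 - Δ) * (star (toC L a₀) ⬝ᵥ ((xxzHamiltonian 1 (torusGraph 2 L) (-1) 1 -
        xxzHamiltonian 1 (torusGraph 2 L) (-1) 0) *ᵥ toC L a₀)).re
  rw [← heψ₀, hψ₀one, hψone]
  rw [hψΔ] at heψ
  rw [hψ₀Δ] at hvar
  linarith

/-- `H_L(1) - H_L(0)` (the Ising part of the pencil) is Hermitian. [folklore] -/
theorem isingPart_conjTranspose :
    (hcbHamiltonian L 1 - hcbHamiltonian L 0)ᴴ = hcbHamiltonian L 1 - hcbHamiltonian L 0 := by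
  rw [conjTranspose_sub, (xxzHamiltonian_isHermitian 1 (torusGraph 2 L) (-1) 1).eq,
    (xxzHamiltonian_isHermitian 1 (torusGraph 2 L) (-1) 0).eq]

/-! ### The FM-end window of the chord -/

/-- **The FM-end chord in an explicit gap window** (crux `FerroSideChord`, stmt-19089; the slice of
the registered stub `stub_fmEndChord` next to `Δ = 1`, at EVERY even side `L`).  Let `a₀` be the
Perron amplitude of the `S^z_tot = 0` ground state of the isotropic ferromagnet `H_L(1)` with a gap
`g > 0` above it in the sector, `D = Σᵢₖ |(H_L(1) - H_L(0))ᵢₖ|`, `σ² = ‖(H_L(1) - H_L(0)) a₀‖²`.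
Then for every `Δ ≤ 1` with `(1 - Δ)·(4Dg + 8σ² + 8) ≤ g²`, every normalised sector ground state
`ψ` of `H_L(Δ)` obeys the chord bound `((1+Δ)/2)·(L²/2)(L²/2+1) ≤ Re⟨ψ, S⁺_tot S⁻_tot ψ⟩`:
the overlap deficit with the Dicke state is `≤ (1-Δ)/2` (`one_sub_sq_overlap_le_half_of_gap`) and
`Λ ≥ S(S+1)·overlap²` (`lambda_toC_ge_ferroValue_mul_sq_overlap`).  Given `FerroPointValue`
(PROVED, `ferroPointValue_proof`). Kato (1966) II-§5.1; Tasaki (2020) App. A.2–A.3. [folklore] -/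
theorem fmEndChord_of_gap (hFPV : FerroPointValue) (hE : Even L)
    {a₀ : TensorIndex (TorusSite 2 L) 2 → ℝ} (ha₀ : IsPerronSectorGroundAmplitude L 1 0 a₀)
    {g : ℝ} (hg : 0 < g)
    (hgap : ∀ w ∈ spinZSector (Λ := TorusSite 2 L) 1 0, star (toC L a₀) ⬝ᵥ w = 0 →
      (lowestEnergyInSector 1 (hcbHamiltonian L 1) 0 + g) * (star w ⬝ᵥ w).re ≤
        (star w ⬝ᵥ hcbHamiltonian L 1 *ᵥ w).re)
    {Δ : ℝ} (hΔ1 : Δ ≤ 1)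
    (hΔ : (1 - Δ) * (4 * (∑ i, ∑ k, ‖(hcbHamiltonian L 1 - hcbHamiltonian L 0) i k‖) * g +
        8 * (star ((hcbHamiltonian L 1 - hcbHamiltonian L 0) *ᵥ toC L a₀) ⬝ᵥ
              ((hcbHamiltonian L 1 - hcbHamiltonian L 0) *ᵥ toC L a₀)).re + 8) ≤ g ^ 2)
    (ψ : TensorIndex (TorusSite 2 L) 2 → ℂ) (hψK : ψ ∈ spinZSector (Λ := TorusSite 2 L) 1 0)
    (hψ1 : star ψ ⬝ᵥ ψ = 1)
    (hψH : hcbHamiltonian L Δ *ᵥ ψ = ((lowestEnergyInSector 1 (hcbHamiltonian L Δ) 0 : ℝ) : ℂ) • ψ) :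
    (1 + Δ) / 2 * ((L : ℝ) ^ 2 / 2 * ((L : ℝ) ^ 2 / 2 + 1)) ≤
      (star ψ ⬝ᵥ (((∑ x : TorusSite 2 L, onSite x (spinRaise 1)) *
        (∑ y : TorusSite 2 L, onSite y (spinLower 1)) : Op (TorusSite 2 L) 2) *ᵥ ψ)).re := by
  -- pass to the Perron amplitude `a` at `Δ`
  have hK := spinZSector_ne_bot_of_unit L hψK hψ1
  obtain ⟨a, ha⟩ := exists_perronAmplitude L Δ 0 hK
  rw [lambda_eq_lowerNormSq_of_sectorGround Δ 0 a ha ψ hψK hψ1 hψH,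
    ← lambda_eq_lowerNormSq_of_sectorGround Δ 0 a ha (toC L a) (toC_mem_of_isPerron L ha)
      (toC_unit_of_isPerron L ha) (hcb_mulVec_toC_of_isPerron L ha)]
  have hov := lambda_toC_ge_ferroValue_mul_sq_overlap L hFPV hE ha₀ ha
  have hdef := one_sub_sq_overlap_le_half_of_gap
    (xxzHamiltonian_isHermitian 1 (torusGraph 2 L) (-1) 1).eq (isingPart_conjTranspose L)
    (spinZSector (Λ := TorusSite 2 L) 1 0) (toC_mem_of_isPerron L ha₀) (toC_unit_of_isPerron L ha₀)
    (hcb_mulVec_toC_of_isPerron L ha₀) hg hgap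
    (fun φ => abs_re_form_le_sum_norm_mul (hcbHamiltonian L 1 - hcbHamiltonian L 0) φ)
    (toC_mem_of_isPerron L ha) (toC_unit_of_isPerron L ha) (star_toC_dotProduct_toC L a₀ a)
    (by linarith) (sectorGS_pencil_variational L ha ha₀) hΔ
  have hS : 0 ≤ (L : ℝ) ^ 2 / 2 * ((L : ℝ) ^ 2 / 2 + 1) := by positivity
  calc (1 + Δ) / 2 * ((L : ℝ) ^ 2 / 2 * ((L : ℝ) ^ 2 / 2 + 1))
      = (L : ℝ) ^ 2 / 2 * ((L : ℝ) ^ 2 / 2 + 1) * ((1 + Δ) / 2) := by ring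
    _ ≤ (L : ℝ) ^ 2 / 2 * ((L : ℝ) ^ 2 / 2 + 1) * (∑ σ, a₀ σ * a σ) ^ 2 :=
        mul_le_mul_of_nonneg_left (by linarith [hdef]) hS
    _ ≤ _ := hov

/-- **FM-END WINDOW OF THE CHORD** (crux `FerroSideChord`, stmt-HubbardSuperconductivity-19089 —
the neighbourhood-of-`Δ = 1` slice of the registered stub `stub_fmEndChord` of the line
`fm-monotone-anchor`, at EVERY even side `L`): given the route item `FerroPointValue` (PROVED in
the tree, `ferroPointValue_proof`; taken by name), there is `ε = ε_L > 0` — explicitly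
`g²/(4Dg + 8σ² + 8)` with the sector gap `g` of the isotropic ferromagnet `H_L(1)` above its Dicke
ground state — such that for every `Δ ∈ [1 - ε, 1]` every normalised `S^z_tot = 0` sector ground
state `ψ` of `H_L(Δ)` satisfies `((1+Δ)/2)·(L²/2)(L²/2+1) ≤ Re⟨ψ, S⁺_tot S⁻_tot ψ⟩`.  (The order
parameter leaves its maximum `S(S+1)` at `Δ = 1` quadratically in `1 - Δ`, the chord linearly.)
The stub asks the chord on the FIXED window `[2/5, 1]` uniformly in `L` (open). [folklore] -/
theorem fmEndChord_window (hFPV : FerroPointValue) (hE : Even L) :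
    ∃ ε > (0 : ℝ), ∀ Δ ∈ Set.Icc (1 - ε) 1, ∀ ψ : TensorIndex (TorusSite 2 L) 2 → ℂ,
      ψ ∈ spinZSector (Λ := TorusSite 2 L) 1 0 → star ψ ⬝ᵥ ψ = 1 →
      hcbHamiltonian L Δ *ᵥ ψ = ((lowestEnergyInSector 1 (hcbHamiltonian L Δ) 0 : ℝ) : ℂ) • ψ →
      (1 + Δ) / 2 * ((L : ℝ) ^ 2 / 2 * ((L : ℝ) ^ 2 / 2 + 1)) ≤
        (star ψ ⬝ᵥ (((∑ x : TorusSite 2 L, onSite x (spinRaise 1)) *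
          (∑ y : TorusSite 2 L, onSite y (spinLower 1)) : Op (TorusSite 2 L) 2) *ᵥ ψ)).re := by
  by_cases hK : spinZSector (Λ := TorusSite 2 L) 1 0 = ⊥
  · refine ⟨1, one_pos, fun Δ _ ψ hψK hψ1 _ => ?_⟩
    exact absurd hK (spinZSector_ne_bot_of_unit L hψK hψ1)
  · obtain ⟨a₀, ha₀⟩ := exists_perronAmplitude L 1 0 hK
    obtain ⟨g, hg, hgap⟩ := perron_gap L 1 0 a₀ ha₀
    have hD0 : 0 ≤ ∑ i, ∑ k, ‖(hcbHamiltonian L 1 - hcbHamiltonian L 0) i k‖ :=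
      Finset.sum_nonneg fun i _ => Finset.sum_nonneg fun k _ => norm_nonneg _
    have hσ0 : 0 ≤ (star ((hcbHamiltonian L 1 - hcbHamiltonian L 0) *ᵥ toC L a₀) ⬝ᵥ
        ((hcbHamiltonian L 1 - hcbHamiltonian L 0) *ᵥ toC L a₀)).re :=
      (Complex.nonneg_iff.mp (dotProduct_star_self_nonneg _)).1
    have hQ : 0 < 4 * (∑ i, ∑ k, ‖(hcbHamiltonian L 1 - hcbHamiltonian L 0) i k‖) * g +
        8 * (star ((hcbHamiltonian L 1 - hcbHamiltonian L 0) *ᵥ toC L a₀) ⬝ᵥ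
          ((hcbHamiltonian L 1 - hcbHamiltonian L 0) *ᵥ toC L a₀)).re + 8 := by positivity
    refine ⟨g ^ 2 / (4 * (∑ i, ∑ k, ‖(hcbHamiltonian L 1 - hcbHamiltonian L 0) i k‖) * g +
        8 * (star ((hcbHamiltonian L 1 - hcbHamiltonian L 0) *ᵥ toC L a₀) ⬝ᵥ
          ((hcbHamiltonian L 1 - hcbHamiltonian L 0) *ᵥ toC L a₀)).re + 8),
      by positivity, fun Δ hΔ ψ hψK hψ1 hψH => ?_⟩
    refine fmEndChord_of_gap L hFPV hE ha₀ hg hgap hΔ.2 ?_ ψ hψK hψ1 hψH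
    have h1 := hΔ.1
    exact (le_div_iff₀ hQ).mp (by linarith)

/-- **Slice of the registered stub `stub_fmEndChord` near `Δ = 1`, in the stub's binder shape**
(line `fm-monotone-anchor` of crux `FerroSideChord`, stmt-19089), given `FerroPointValue` (PROVED,
`ferroPointValue_proof`): for every even `M ≥ 4` there is `ε > 0` with the chord bound
`((1+Δ)/2)·(M²/2)(M²/2+1) ≤ Re⟨ψ, S⁺_tot S⁻_tot ψ⟩` for all `Δ ∈ [1-ε, 1]` and all normalised
`S^z_tot = 0` sector ground states `ψ` of `H_M(Δ)`.  The stub itself (the fixed window `[2/5, 1]`,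
uniformly in `M`) remains open. [folklore] -/
theorem fmEndChord_nearOne (hFPV : FerroPointValue) :
    ∀ (M : ℕ) [NeZero M], Even M → 4 ≤ M → ∃ ε > (0 : ℝ), ∀ Δ ∈ Set.Icc (1 - ε) 1,
      ∀ (ψ : TensorIndex (TorusSite 2 M) 2 → ℂ),
      ψ ∈ spinZSector (Λ := TorusSite 2 M) 1 0 → star ψ ⬝ᵥ ψ = 1 →
      Matrix.mulVec (xxzHamiltonian 1 (torusGraph 2 M) (-1) Δ) ψ =
        ((lowestEnergyInSector 1 (xxzHamiltonian 1 (torusGraph 2 M) (-1) Δ) 0 : ℝ) : ℂ) • ψ →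
      (1 + Δ) / 2 * ((M : ℝ) ^ 2 / 2 * ((M : ℝ) ^ 2 / 2 + 1)) ≤
        (star ψ ⬝ᵥ Matrix.mulVec ((∑ x : TorusSite 2 M, onSite x (spinRaise 1)) *
          (∑ y : TorusSite 2 M, onSite y (spinLower 1))) ψ).re := by
  intro M _ hE _h4
  exact fmEndChord_window M hFPV hE

end Summit.HubbardSuperconductivity.HubbardSuperconductivity.Theorems.AnisotropyChord.FerroSide

end
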